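import Summits.CriticalPhenomena.PercolationContinuityZ3.Theorems.Transplant.GrigorchukLamplighterCayleyClasses
import HarnessLib

/-!
# LABEL RIGIDITY of Bartholdi–Erschler's Cayley graph `Cay(ℤ ≀_X 𝔊; a, b, c, d, s)`: every graph automorphism preserves each edge label
# `a, b, c, d` and maps `s`-edges to `s^{±1}`-edges (part II: the alternating walks and the theorem)

builds on p205010 (kernel theorem, internal audit signed; external expert review pending) — nothing in this file uses p205010; graph theory of ONE Cayley
graph, no percolation statement, nothing about any `@[conjecture]`.  Lane `prim-bschramm`, seat `prim-bschramm-p3` gen 36 (DESIGN OWNER;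
`P3-NILPOTENT.md` §29.1–29.2).  Helper file (`--supports stmt-CriticalPhenomena-4575 --as helper`).

THE CENSUS, continued from «GrigorchukLamplighterCayleyClasses» (refuter conditions (2a)/(2b), lead g25 ruling O14; order tri → sq → alt8 → alt16):
`Alt8 u v` (a closed 8-walk `T A T A T A T A` from `u` through `v`) holds at `d`-edges (`(da)⁴ = 1`) and fails at `b`/`c`-edges (the 54 certified words of
«GrigorchukFiniteModel», SOUND direction only); `Alt16` (closed 16-walk alternating `T ∧ ¬Alt8` / `A`) holds at `c`-edges (`(ca)⁸ = 1`) and fails at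
`b`-edges (the 128 certified words).  MAIN THEOREM `Grigorchuk.cay_label_rigid (φ : Cay ≃g Cay) (u) : φ (u·a) = φ u · a ∧ φ (u·b) = φ u · b ∧
φ (u·c) = φ u · c ∧ φ (u·d) = φ u · d ∧ (φ (u·s) = φ u · s ∨ φ (u·s) = φ u · s⁻¹)` — the two rules of «AutChartOrbitsOneLampAutDefs» `LabelAction` hold for
EVERY automorphism of B–E's Cayley graph (caveat (α) of the lane's record): its automorphism group consists of label-preserving maps (and the sign patterns
`(f, g) ↦ (η·f, g)` show the `s`-orientation really can flip, `P3-NILPOTENT` §29.0).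
[cite: BartholdiErschler2012, §2–§3.1] [cite: BenjaminiSchramm1996, §2 (Cayley graphs)] [cite: Grigorchuk1980, relations of 𝔊]
-/

noncomputable section

namespace Summit.CriticalPhenomena.PercolationContinuityZ3.Theorems.Transplant

namespace Grigorchuk

open SimpleGraph SemidirectProduct
open scoped Classical

/-! ### §4 The alternating walks: `d` versus `b, c`, then `c` versus `b` -/

/-- A code names `b` or `c`. [folklore] -/
def L6.isBC : L6 → Bool
  | .b => true
  | .c => true
  | _ => false

/-- A `b/c` code names `W ℓ` for a p590723 letter `ℓ ∈ {b, c}`. [folklore] -/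
theorem exists_letter_of_isBC {y : L6} (h : y.isBC = true) : ∃ ℓ : Letter, ℓ.isBC = true ∧ y.toW = W ℓ := by
  cases y
  · exact absurd h (by decide)
  · exact ⟨.x .b, rfl, rfl⟩
  · exact ⟨.x .c, rfl, rfl⟩
  · exact absurd h (by decide)
  · exact absurd h (by decide)
  · exact absurd h (by decide)

/-- The alternating word of a list of codes: `t₁ a t₂ a ⋯ t_n a`. [folklore] -/
def altProd : List L6 → ↥wreathZ
  | [] => 1
  | t :: ts => t.toW * aW * altProd ts

/-- **Building an alternating return along powers of `t a`.** [folklore] -/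
theorem altRet_pow {P : ↥wreathZ → ↥wreathZ → Prop} {t : L6} (hT : ∀ v : ↥wreathZ, P v (v * t.toW)) :
    ∀ (n : ℕ) (x : ↥wreathZ), AltRet Cay P n x (x * (t.toW * aW) ^ n) := by
  intro n
  induction n with
  | zero => intro x; rw [pow_zero, mul_one]; rfl
  | succ n ih =>
    intro x
    refine ⟨x * t.toW, x * t.toW * aW, hT x, (classes (x * t.toW)).1, ?_⟩
    have e : x * (t.toW * aW) ^ (n + 1) = x * t.toW * aW * (t.toW * aW) ^ n := by rw [pow_succ', ← mul_assoc, ← mul_assoc]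
    rw [e]
    exact ih _

/-- **Reading the letters off an alternating return**: if `P ⊆ IsT` and `P` at an edge `v — v·t` forces `Q t`, then `AltRet P n w y` gives
`y = w · (t₁ a ⋯ t_n a)` with `n` codes all satisfying `Q`. [folklore] -/
theorem altRet_letters {P : ↥wreathZ → ↥wreathZ → Prop} (hP : ∀ u v, P u v → IsT Cay u v) {Q : L6 → Prop}
    (hQ : ∀ (v : ↥wreathZ) (t : L6), P v (v * t.toW) → Q t) :
    ∀ (n : ℕ) {w y : ↥wreathZ}, AltRet Cay P n w y → ∃ ts : List L6, ts.length = n ∧ (∀ t ∈ ts, Q t) ∧ y = w * altProd ts := by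
  intro n
  induction n with
  | zero =>
    intro w y h
    exact ⟨[], rfl, fun _ h => by simp at h, by rw [altProd, mul_one]; exact h.symm⟩
  | succ n ih =>
    rintro w y ⟨v, x, h1, h2, h3⟩
    obtain ⟨t, -, rfl⟩ := exists_of_isT (hP _ _ h1)
    have hx := eq_of_isA h2
    subst hx
    obtain ⟨ts, hlen, hQts, rfl⟩ := ih h3
    refine ⟨t :: ts, by rw [List.length_cons, hlen], ?_, by rw [altProd, ← mul_assoc, ← mul_assoc]⟩
    intro t' ht'
    rw [List.mem_cons] at ht'
    rcases ht' with rfl | ht'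
    · exact hQ w _ h1
    · exact hQts _ ht'

/-- `(d a)⁴ = 1` and `(c a)⁸ = 1` in `Γ₂` (conjugates of `(a d)⁴`, `(a c)⁸`). [cite: Grigorchuk1980, (ad)⁴ = 1] -/
theorem dW_aW_pow_four_and : (dW * aW) ^ 4 = 1 ∧ (cW * aW) ^ 8 = 1 := by
  have e : ∀ t : ↥wreathZ, t * aW = aW⁻¹ * (aW * t) * aW⁻¹⁻¹ := fun t => by
    rw [inv_inv, letters_inv.1, ← mul_assoc, tree_letters_sq.1, one_mul]
  constructor
  · rw [e, conj_pow, aW_dW_pow_four, mul_one, inv_inv, inv_mul_cancel]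
  · rw [e, conj_pow, aW_cW_pow_eight, mul_one, inv_inv, inv_mul_cancel]

/-- **`d`-edges lie on an alternating `T/A` closed 8-walk** (`(d a)⁴ = 1`). [folklore] -/
theorem alt8_d (u : ↥wreathZ) : Alt8 Cay u (u * dW) := by
  refine ⟨(classes u).2.1 .d rfl, u * dW * aW, (classes _).1, ?_⟩
  have h := altRet_pow (P := IsT Cay) (t := .d) (fun v => (classes v).2.1 .d rfl) 3 (u * dW * aW)
  have e : u * dW * aW * (L6.d.toW * aW) ^ 3 = u := by
    show u * dW * aW * (dW * aW) ^ 3 = u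
    rw [mul_assoc u, mul_assoc u, ← pow_succ', dW_aW_pow_four_and.1, mul_one]
  rwa [e] at h

/-- **`b`- and `c`-edges lie on NO alternating `T/A` closed 8-walk** (the 54 certified words). [folklore] -/
theorem not_alt8_bc (u : ↥wreathZ) {y : L6} (hy : y.isBC = true) : ¬ Alt8 Cay u (u * y.toW) := by
  rintro ⟨-, w, hA, hret⟩
  have hw := eq_of_isA hA
  subst hw
  obtain ⟨ts, hlen, htree, hu⟩ :=
    altRet_letters (P := IsT Cay) (fun _ _ h => h) (Q := fun t => t.isTree = true) (fun v t h => (triE_iff v t).1 h.2) 3 hret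
  -- three tree codes
  obtain ⟨t₁, t₂, t₃, rfl⟩ := List.length_eq_three.1 hlen
  · obtain ⟨ℓ₀, hℓ₀, e₀⟩ := exists_letter_of_isBC hy
    obtain ⟨ℓ₁, hℓ₁, e₁⟩ := exists_letter_of_isTree (htree t₁ (by simp))
    obtain ⟨ℓ₂, hℓ₂, e₂⟩ := exists_letter_of_isTree (htree t₂ (by simp))
    obtain ⟨ℓ₃, hℓ₃, e₃⟩ := exists_letter_of_isTree (htree t₃ (by simp))
    refine alt8W_ne_one ℓ₀ ℓ₁ ℓ₂ ℓ₃ hℓ₀ hℓ₁ hℓ₂ hℓ₃ ?_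
    rw [← e₀, ← e₁, ← e₂, ← e₃]
    have h2 : u * (y.toW * aW * altProd [t₁, t₂, t₃]) = u * 1 := by rw [mul_one, ← mul_assoc, ← mul_assoc]; exact hu.symm
    have h3 := mul_left_cancel h2
    simp only [altProd, mul_one, ← mul_assoc] at h3
    exact h3

/-- **`c`-edges lie on an alternating `(T ∧ ¬Alt8)/A` closed 16-walk** (`(c a)⁸ = 1`). [folklore] -/
theorem alt16_c (u : ↥wreathZ) : Alt16 Cay u (u * cW) := by
  have hBC : ∀ v : ↥wreathZ, IsBC Cay v (v * L6.c.toW) := fun v => ⟨(classes v).2.1 .c rfl, not_alt8_bc v (y := .c) rfl⟩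
  refine ⟨hBC u, u * cW * aW, (classes _).1, ?_⟩
  have h := altRet_pow (P := IsBC Cay) (t := .c) hBC 7 (u * cW * aW)
  have e : u * cW * aW * (L6.c.toW * aW) ^ 7 = u := by
    show u * cW * aW * (cW * aW) ^ 7 = u
    rw [mul_assoc u, mul_assoc u, ← pow_succ', dW_aW_pow_four_and.2, mul_one]
  rwa [e] at h

/-- **`b`-edges lie on NO alternating `(T ∧ ¬Alt8)/A` closed 16-walk** (the 128 certified words). [folklore] -/
theorem not_alt16_b (u : ↥wreathZ) : ¬ Alt16 Cay u (u * bW) := by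
  rintro ⟨-, w, hA, hret⟩
  have hw := eq_of_isA hA
  subst hw
  have hQ : ∀ (v : ↥wreathZ) (t : L6), IsBC Cay v (v * t.toW) → t.isBC = true := by
    intro v t ⟨hT, hn8⟩
    have ht := (triE_iff v t).1 hT.2
    cases t
    · exact absurd ht (by decide)
    · rfl
    · rfl
    · exact absurd (alt8_d v) hn8
    · exact absurd ht (by decide)
    · exact absurd ht (by decide)
  obtain ⟨ts, hlen, hbc, hu⟩ := altRet_letters (P := IsBC Cay) (fun _ _ h => h.1) (Q := fun t => t.isBC = true) hQ 7 hret
  obtain ⟨t₂, ts, rfl⟩ := List.exists_cons_of_length_eq_add_one hlen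
  obtain ⟨t₃, ts, rfl⟩ := List.exists_cons_of_length_eq_add_one (Nat.succ.inj hlen)
  obtain ⟨t₄, ts, rfl⟩ := List.exists_cons_of_length_eq_add_one (Nat.succ.inj (Nat.succ.inj hlen))
  obtain ⟨t₅, ts, rfl⟩ := List.exists_cons_of_length_eq_add_one (Nat.succ.inj (Nat.succ.inj (Nat.succ.inj hlen)))
  obtain ⟨t₆, ts, rfl⟩ := List.exists_cons_of_length_eq_add_one (Nat.succ.inj (Nat.succ.inj (Nat.succ.inj (Nat.succ.inj hlen))))
  obtain ⟨t₇, ts, rfl⟩ := List.exists_cons_of_length_eq_add_one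
    (Nat.succ.inj (Nat.succ.inj (Nat.succ.inj (Nat.succ.inj (Nat.succ.inj hlen)))))
  obtain ⟨t₈, ts, rfl⟩ := List.exists_cons_of_length_eq_add_one
    (Nat.succ.inj (Nat.succ.inj (Nat.succ.inj (Nat.succ.inj (Nat.succ.inj (Nat.succ.inj hlen))))))
  obtain rfl : ts = [] := List.eq_nil_of_length_eq_zero
    (Nat.succ.inj (Nat.succ.inj (Nat.succ.inj (Nat.succ.inj (Nat.succ.inj (Nat.succ.inj (Nat.succ.inj hlen)))))))
  · obtain ⟨ℓ₂, hℓ₂, e₂⟩ := exists_letter_of_isBC (hbc t₂ (by simp))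
    obtain ⟨ℓ₃, hℓ₃, e₃⟩ := exists_letter_of_isBC (hbc t₃ (by simp))
    obtain ⟨ℓ₄, hℓ₄, e₄⟩ := exists_letter_of_isBC (hbc t₄ (by simp))
    obtain ⟨ℓ₅, hℓ₅, e₅⟩ := exists_letter_of_isBC (hbc t₅ (by simp))
    obtain ⟨ℓ₆, hℓ₆, e₆⟩ := exists_letter_of_isBC (hbc t₆ (by simp))
    obtain ⟨ℓ₇, hℓ₇, e₇⟩ := exists_letter_of_isBC (hbc t₇ (by simp))
    obtain ⟨ℓ₈, hℓ₈, e₈⟩ := exists_letter_of_isBC (hbc t₈ (by simp))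
    refine alt16W_ne_one ℓ₂ ℓ₃ ℓ₄ ℓ₅ ℓ₆ ℓ₇ ℓ₈ hℓ₂ hℓ₃ hℓ₄ hℓ₅ hℓ₆ hℓ₇ hℓ₈ ?_
    rw [← e₂, ← e₃, ← e₄, ← e₅, ← e₆, ← e₇, ← e₈]
    have h2 : u * (bW * aW * altProd [t₂, t₃, t₄, t₅, t₆, t₇, t₈]) = u * 1 := by
      rw [mul_one, ← mul_assoc, ← mul_assoc]; exact hu.symm
    have h3 := mul_left_cancel h2
    simp only [altProd, mul_one, ← mul_assoc] at h3
    exact h3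

/-! ### §5 Label rigidity -/

/-- **LABEL RIGIDITY OF `Cay(ℤ ≀_X 𝔊; a, b, c, d, s)`.**  Every graph automorphism `φ` satisfies `φ (u·a) = φ u · a`, `φ (u·b) = φ u · b`, `φ (u·c) = φ u · c`,
`φ (u·d) = φ u · d` and `φ (u·s) ∈ {φ u · s, φ u · s⁻¹}` at every vertex `u` — the edge labels are intrinsic: `a` = no triangle and no `T`-cornered square,
`s^{±}` = no triangle but a `T`-cornered square, `{b,c,d}` = in a triangle, `d` = on an alternating 8-walk, `c` = on an alternating 16-walk, `b` = neither.
(So Aut of this Cayley graph consists of label-preserving maps; the sign patterns `(f, g) ↦ (η·f, g)` show the `s`-orientation really can flip.)  Lane record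
`P3-NILPOTENT.md` §29.1. [cite: BartholdiErschler2012, §2–§3.1] -/
theorem cay_label_rigid (φ : Cay ≃g Cay) (u : ↥wreathZ) :
    φ (u * aW) = φ u * aW ∧ φ (u * bW) = φ u * bW ∧ φ (u * cW) = φ u * cW ∧ φ (u * dW) = φ u * dW ∧
      (φ (u * sW) = φ u * sW ∨ φ (u * sW) = φ u * sW⁻¹) := by
  obtain ⟨hA, hT, hS, -⟩ := classes u
  refine ⟨?_, ?_, ?_, ?_, ?_⟩
  · -- `a`: the image edge is of class `A`
    exact eq_of_isA ((isA_map_iff φ).2 hA)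
  · -- `b`: class `T`, not `Alt8`, not `Alt16`
    obtain ⟨y, hy, e⟩ := exists_of_isT ((isT_map_iff φ).2 (hT .b rfl))
    have e' : φ (u * bW) = φ u * y.toW := e
    have hn8 : ¬ Alt8 Cay (φ u) (φ u * y.toW) := e ▸ (alt8_map_iff φ).not.2 (not_alt8_bc u (y := .b) rfl)
    have hn16 : ¬ Alt16 Cay (φ u) (φ u * y.toW) := e ▸ (alt16_map_iff φ).not.2 (not_alt16_b u)
    rw [e']
    cases y
    · exact absurd hy (by decide)
    · rfl
    · exact absurd (alt16_c (φ u)) hn16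
    · exact absurd (alt8_d (φ u)) hn8
    · exact absurd hy (by decide)
    · exact absurd hy (by decide)
  · -- `c`: class `T`, not `Alt8`, `Alt16`
    obtain ⟨y, hy, e⟩ := exists_of_isT ((isT_map_iff φ).2 (hT .c rfl))
    have e' : φ (u * cW) = φ u * y.toW := e
    have hn8 : ¬ Alt8 Cay (φ u) (φ u * y.toW) := e ▸ (alt8_map_iff φ).not.2 (not_alt8_bc u (y := .c) rfl)
    have h16 : Alt16 Cay (φ u) (φ u * y.toW) := e ▸ (alt16_map_iff φ).2 (alt16_c u)
    rw [e']
    cases y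
    · exact absurd hy (by decide)
    · exact absurd h16 (not_alt16_b (φ u))
    · rfl
    · exact absurd (alt8_d (φ u)) hn8
    · exact absurd hy (by decide)
    · exact absurd hy (by decide)
  · -- `d`: class `T`, `Alt8`
    obtain ⟨y, hy, e⟩ := exists_of_isT ((isT_map_iff φ).2 (hT .d rfl))
    have e' : φ (u * dW) = φ u * y.toW := e
    have h8 : Alt8 Cay (φ u) (φ u * y.toW) := e ▸ (alt8_map_iff φ).2 (alt8_d u)
    rw [e']
    cases y
    · exact absurd hy (by decide)
    · exact absurd h8 (not_alt8_bc (φ u) (y := .b) rfl)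
    · exact absurd h8 (not_alt8_bc (φ u) (y := .c) rfl)
    · rfl
    · exact absurd hy (by decide)
    · exact absurd hy (by decide)
  · -- `s`: class `S`
    exact eq_of_isS ((isS_map_iff φ).2 hS)

/-- **Corollary: every automorphism commutes with right multiplication by each tree letter** (closure form, for the whole tree subgroup, is in the
customer file). [folklore] -/
theorem cay_aut_mul_tree (φ : Cay ≃g Cay) (u : ↥wreathZ) (y : L6) (hy : y = .a ∨ y.isTree = true) : φ (u * y.toW) = φ u * y.toW := by
  obtain ⟨ha, hb, hc, hd, -⟩ := cay_label_rigid φ u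
  rcases hy with rfl | hy
  · exact ha
  · cases y
    · exact absurd hy (by decide)
    · exact hb
    · exact hc
    · exact hd
    · exact absurd hy (by decide)
    · exact absurd hy (by decide)

end Grigorchuk

end Summit.CriticalPhenomena.PercolationContinuityZ3.Theorems.Transplant
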